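import Mathlib
import Summits.ResolutionOfSingularities.ResolutionOfSingularities.Theorems.HomologicalConductorNoZenoFullSheafStalksFree
import Summits.ResolutionOfSingularities.ResolutionOfSingularities.Theorems.HomologicalConductorNoZenoFullSheafAffine
import Literature.AlgebraicGeometry.Modules.AffineVectorBundleSections
import HarnessLib

/-!
# Full sheaves: free stalk lattices ⇒ `M̃` is finite locally free (G2 (iv), chain W4.4)

`[OURS · L W4.4]` Crux `HomologicalConductor.NoZenoR` (stmt-ResolutionOfSingularities-19943; twin `NoZeno`
stmt-16483), line `sandwich-cluster`, S3 Layer 2, G-layer item **G2 (iv) «the full sheaf `M̃` is locally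
free»** (holder's cut 2026-08-27T06:00:41Z: this seat), in the G2 convention of res-D-pv-045's
`SketchG2Split.lean`.  Last step of the route (after p505405 Hartogs, p506251 punctured neighbourhood,
p506925 Čech cocycle, p508328 free stalk lattices):

* `fn_smul_eq_germ_smul`, `exists_section_apply_eq_germ_smul` — the value map
  `Γ(U, 𝒪_X · S) → 𝒪_{X,x} · S` at the point `x` of an affine open `U` is `Γ(X, U)`-linear and becomes
  surjective after clearing a denominator outside the prime of `x`;
* **`isFiniteLocallyFree_of_free_stalkSpan`** — for ANY full sheaf `𝒪_X · S` (`S ⊆ V`, `V` a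
  `K(X)`-vector space, `X` integral locally noetherian) of affine-finite type: if every stalk lattice
  `𝒪_{X,x} · S` is a free `𝒪_{X,x}`-module then `𝒪_X · S` is finite locally free.  Proof: over an affine
  open `U` the `Γ(X, U)`-module `Γ(U, 𝒪_X · S)` localises at the maximal ideal of a point `x` to the
  stalk lattice `𝒪_{X,x} · S` (value map), so it is finitely presented with projective localisations,
  hence projective (Mathlib `Module.projective_of_localization_maximal'`); an affine-localizing module
  (p502652 `isAffineLocalizing_generatedSheaf`) with finite projective sections over an affine open is free
  on a basic open around each point (`Modules/AffineVectorBundleSections`, Görtz–Wedhorn I Cor. 7.42);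
* `isAffineFiniteType_generatedSheaf_range` — `𝒪_X · φ(M)` is of affine-finite type for `M` finitely
  generated and `φ` semilinear along `T → K(X)`;
* **`fullSheaf_isFiniteLocallyFree_of_cechH1`** — G2 (iv) in the `SketchG2Split` signature with G2 (iii)
  (`Ȟ¹(𝒰, M̃) = 0` on finite affine covers, res-D-pv-024) as the hypothesis `hH1`: for `π : X ⟶ Spec T` a
  resolution of a two-dimensional noetherian normal local domain, `M` finitely generated reflexive and
  `φ : M ↪ K(X)^r` `T`-semilinear, **the full sheaf `M̃ = 𝒪_X · φ(M)` is finite locally free**.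

Replaces the role of no printed item of the manuscript under review (Hironaka 2017); AI-written, weaker
than expert review. [cite: ArtinVerdier1985, Lemma (1.1) (ii)] [cite: GortzWedhorn2020, Cor. 7.42]
-/

-- single-problem summit: the doubled namespace component `ResolutionOfSingularities` is forced
set_option linter.dupNamespace false

noncomputable section

open CategoryTheory AlgebraicGeometry TopologicalSpace Opposite
open Literature.AlgebraicGeometry.Resolution Literature.AlgebraicGeometry.Motives
open Literature.AlgebraicGeometry.Morphisms Literature.AlgebraicGeometry.Modules

universe u

namespace Summit.ResolutionOfSingularities.ResolutionOfSingularities.Theorems.NoZeno.SandwichCluster.FullSheaf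

section Generic

variable {X : Scheme.{u}} [IsIntegral X]
variable (V : Type u) [AddCommGroup V] [Module X.functionField V] (S : Set V)

/-! ## The value map at a point of an affine open -/

omit [IsIntegral X] in
/-- The points of `Spec Γ(X, U) ≅ U` lie in `U`. [folklore] -/
theorem fromSpec_mem {U : X.Opens} (hU : IsAffineOpen U) (y : PrimeSpectrum Γ(X, U)) :
    (hU.fromSpec y : X) ∈ U := by
  have h := Set.mem_range_self (f := fun p => (hU.fromSpec p : X)) y
  rwa [hU.range_fromSpec] at h

/-- The `Γ(X, U)`-action on sections of `𝒪_X · S` is the germ action on values: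
`(g • s)(x) = (g)_x • s(x)`. [folklore] -/
theorem fn_smul_eq_germ_smul {U : X.Opens} (g : Γ(X, U)) (s : Γ(generatedSheaf V S, U)) (x : U) :
    fn V S (g • s) x = (letI := stalkModule V x.1; (X.presheaf.germ U x.1 x.2 g) • fn V S s x) := by
  haveI : Nonempty U := ⟨x⟩
  letI := stalkModule V x.1
  letI := baseModule V U
  rw [fn_smul, evalFn_smul_eq_base_smul, base_smul_eq_germ_smul V U x.2]

/-- **Values up to a denominator** (`U` affine): every `v ∈ 𝒪_{X,x} · S`, `x ∈ U` the point of the prime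
`𝔭 ⊆ Γ(X, U)`, is `(b)_x⁻¹ • s(x)` for a section `s ∈ Γ(U, 𝒪_X · S)` and some `b ∉ 𝔭`
(p502652 `exists_not_mem_smul_mem_span`, `exists_fn_apply_eq`). [folklore] -/
theorem exists_section_apply_eq_germ_smul {U : X.Opens} (hU : IsAffineOpen U) [Nonempty U]
    (y : PrimeSpectrum Γ(X, U)) (v : V) (hv : v ∈ stalkSpan V S (hU.fromSpec y)) :
    ∃ b : Γ(X, U), b ∉ y.asIdeal ∧ ∃ s : Γ(generatedSheaf V S, U),
      fn V S s ⟨hU.fromSpec y, fromSpec_mem hU y⟩ =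
        (letI := stalkModule V (hU.fromSpec y);
          (X.presheaf.germ U (hU.fromSpec y) (fromSpec_mem hU y) b) • v) := by
  letI := stalkModule V (hU.fromSpec y)
  letI := baseModule V U
  obtain ⟨b, hb, hbv⟩ := exists_not_mem_smul_mem_span V S hU y v hv
  obtain ⟨s, hs⟩ := exists_fn_apply_eq V S hU ⟨_, fromSpec_mem hU y⟩ (b • v) hbv
  exact ⟨b, hb, s, by rw [hs, base_smul_eq_germ_smul V U (fromSpec_mem hU y)]⟩

/-! ## Free stalk lattices ⇒ finite locally free -/

/-- **Free stalks ⇒ locally free, for full sheaves.**  Let `X` be an integral locally noetherian scheme,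
`S ⊆ V` a subset of a `K(X)`-vector space with `𝒪_X · S` of affine-finite type.  If every stalk lattice
`𝒪_{X,x} · S` is a free `𝒪_{X,x}`-module, then `𝒪_X · S` is finite locally free: over an affine open `U`
the finitely presented `Γ(X, U)`-module `Γ(U, 𝒪_X · S)` has the stalk lattices as its localisations at the
maximal ideals (value maps), so it is projective (Mathlib `Module.projective_of_localization_maximal'`),
and finite projective sections of an affine-localizing module give frames on basic opens
(`Modules/AffineVectorBundleSections.exists_free_over_basicOpen_of_projective_sections`).
[cite: GortzWedhorn2020, Cor. 7.42] -/
theorem isFiniteLocallyFree_of_free_stalkSpan [IsLocallyNoetherian X]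
    (hft : IsAffineFiniteType (generatedSheaf (X := X) V S))
    (hfree : ∀ x : X, letI := stalkModule V x; Module.Free (X.presheaf.stalk x) (stalkSpan V S x)) :
    IsFiniteLocallyFree (generatedSheaf (X := X) V S) := by
  intro x
  -- an affine open neighbourhood `U` of `x`
  obtain ⟨U, hU, hxU, -⟩ := exists_isAffineOpen_mem_and_subset (X := X) (x := x) (U := ⊤) trivial
  haveI : Nonempty U := ⟨⟨x, hxU⟩⟩
  haveI : IsNoetherianRing Γ(X, U) := IsLocallyNoetherian.component_noetherian ⟨U, hU⟩
  haveI : Module.Finite Γ(X, U) Γ(generatedSheaf V S, U) := hft hU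
  -- the stalks at the points `x_y` (`y` a prime of `Γ(X, U)`) as `Γ(X, U)`-algebras, the stalk
  -- lattices `𝒪_{X,x_y} · S` as `Γ(X, U)`-modules
  letI algY : ∀ y : PrimeSpectrum Γ(X, U), Algebra Γ(X, U) (X.presheaf.stalk (hU.fromSpec y)) :=
    fun y => TopCat.Presheaf.algebra_section_stalk X.presheaf ⟨hU.fromSpec y, fromSpec_mem hU y⟩
  have locY : ∀ y : PrimeSpectrum Γ(X, U),
      IsLocalization.AtPrime (X.presheaf.stalk (hU.fromSpec y)) y.asIdeal :=
    fun y => hU.isLocalization_stalk' y (fromSpec_mem hU y)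
  letI modY : ∀ y : PrimeSpectrum Γ(X, U), Module Γ(X, U) (stalkSpan V S (hU.fromSpec y)) :=
    fun y => Module.compHom (stalkSpan V S (hU.fromSpec y))
      (X.presheaf.germ U (hU.fromSpec y) (fromSpec_mem hU y)).hom
  have towY : ∀ y : PrimeSpectrum Γ(X, U),
      IsScalarTower Γ(X, U) (X.presheaf.stalk (hU.fromSpec y)) (stalkSpan V S (hU.fromSpec y)) :=
    fun y => ⟨fun g t m => by
      change (X.presheaf.germ U (hU.fromSpec y) (fromSpec_mem hU y) g * t) • m =
        X.presheaf.germ U (hU.fromSpec y) (fromSpec_mem hU y) g • t • m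
      exact mul_smul _ _ _⟩
  -- the value maps `Γ(U, 𝒪_X · S) → 𝒪_{X,x_y} · S`
  let f : ∀ y : PrimeSpectrum Γ(X, U),
      Γ(generatedSheaf V S, U) →ₗ[Γ(X, U)] stalkSpan V S (hU.fromSpec y) := fun y =>
    { toFun := fun s => ⟨fn V S s ⟨hU.fromSpec y, fromSpec_mem hU y⟩, fn_mem_stalkSpan V S s _⟩
      map_add' := fun _ _ => rfl
      map_smul' := fun g s => Subtype.ext (fn_smul_eq_germ_smul V S g s ⟨hU.fromSpec y, fromSpec_mem hU y⟩) }
  -- they are localisations at the primes of `Γ(X, U)`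
  have lmY : ∀ y : PrimeSpectrum Γ(X, U), IsLocalizedModule y.asIdeal.primeCompl (f y) := fun y =>
    { map_units := fun b => by
        have hu : IsUnit (X.presheaf.germ U (hU.fromSpec y) (fromSpec_mem hU y) (b : Γ(X, U))) :=
          @IsLocalization.map_units _ _ _ _ _ _ (locY y) b
        rw [Module.End.isUnit_iff]
        have e : ⇑(algebraMap Γ(X, U) (Module.End Γ(X, U) (stalkSpan V S (hU.fromSpec y))) b) =
            fun m : stalkSpan V S (hU.fromSpec y) =>
              X.presheaf.germ U (hU.fromSpec y) (fromSpec_mem hU y) (b : Γ(X, U)) • m := by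
          funext m
          rfl
        rw [e]
        exact hu.smul_bijective
      surj := fun m => by
        obtain ⟨b, hb, s, hs⟩ := exists_section_apply_eq_germ_smul V S hU y m.1 m.2
        exact ⟨(s, ⟨b, hb⟩), Subtype.ext hs.symm⟩
      exists_of_eq := fun h =>
        ⟨1, by rw [fn_apply_injective V S ⟨hU.fromSpec y, fromSpec_mem hU y⟩ (congrArg Subtype.val h)]⟩ }
  -- hence `Γ(U, 𝒪_X · S)` is projective (its localisations at the maximal ideals are free)
  haveI : Module.Projective Γ(X, U) Γ(generatedSheaf V S, U) :=
    @Module.projective_of_localization_maximal' Γ(X, U) Γ(generatedSheaf V S, U) _ _ _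
      (fun P hP => X.presheaf.stalk (hU.fromSpec ⟨P, hP.isPrime⟩)) (fun P hP => inferInstance)
      (fun P hP => algY ⟨P, hP.isPrime⟩) (fun P hP => locY ⟨P, hP.isPrime⟩)
      (fun P hP => stalkSpan V S (hU.fromSpec ⟨P, hP.isPrime⟩)) (fun P hP => inferInstance)
      (fun P hP => modY ⟨P, hP.isPrime⟩) (fun P hP => inferInstance) (fun P hP => towY ⟨P, hP.isPrime⟩)
      (fun P hP => f ⟨P, hP.isPrime⟩) (fun P hP => lmY ⟨P, hP.isPrime⟩)
      (fun P hP => by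
        haveI := hfree (hU.fromSpec ⟨P, hP.isPrime⟩)
        exact Module.Projective.of_free)
      (Module.finitePresentation_of_finite _ _)
  -- and free on a basic open around `x`
  obtain ⟨g, hxg, ι, hι, e⟩ := exists_free_over_basicOpen_of_projective_sections
    (isAffineLocalizing_generatedSheaf V S) hU hxU
  exact ⟨X.basicOpen g, hxg, ι, hι, e⟩

end Generic

/-! ## The full sheaf `𝒪_X · φ(M)` of the crux -/

variable {T : Type} [CommRing T]
variable {X : Scheme.{0}} [IsIntegral X] (π : X ⟶ Spec (.of T))
variable {M : Type} [AddCommGroup M] [Module T M] {r : ℕ} (φ : M →+ (Fin r → X.functionField))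

/-- **`𝒪_X · φ(M)` is of affine-finite type**: over a non-empty affine open `U` its sections are
`Γ(X, U) · φ(M) = Γ(X, U) · φ(G)` for generators `G` of `M` (`T` acts through `Γ(X, U)`), p502652
`sectionsEquivSpan`. [folklore] -/
theorem isAffineFiniteType_generatedSheaf_range [Module.Finite T M]
    (hφ : ∀ (a : T) (m : M), φ (a • m) = baseToFunctionField π a • φ m) :
    IsAffineFiniteType (generatedSheaf (X := X) (Fin r → X.functionField) (Set.range φ)) := by
  intro U hU
  let W := Fin r → X.functionField
  rcases isEmpty_or_nonempty U with hUe | ⟨⟨x⟩⟩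
  · -- over the empty open every section is `0`
    refine ⟨⟨∅, ?_⟩⟩
    rw [Finset.coe_empty, Submodule.span_empty]
    refine le_antisymm bot_le fun s _ => ?_
    rw [Submodule.mem_bot]
    exact section_ext W _ (funext fun y => (hUe.false y).elim)
  · haveI : Nonempty U := ⟨x⟩
    haveI : Nonempty (⊤ : X.Opens) := ⟨⟨x.1, trivial⟩⟩
    letI := baseModule W U
    -- `T` acts on `K(X)^r` through `Γ(X, U)`
    have hbase : ∀ a : T, baseToFunctionField π a =
        X.germToFunctionField U (X.presheaf.map (homOfLE le_top).op
          (Literature.AlgebraicGeometry.Morphisms.algebraMapΓ π a)) := fun a => by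
      rw [germToFunctionField_map (X := X) le_top]
      rfl
    obtain ⟨G, hG⟩ := Module.Finite.fg_top (R := T) (M := M)
    have hspan : Submodule.span Γ(X, U) (Set.range φ) = Submodule.span Γ(X, U) (φ '' (G : Set M)) := by
      apply le_antisymm
      · rw [Submodule.span_le]
        rintro _ ⟨m, rfl⟩
        have hm : m ∈ Submodule.span T (G : Set M) := hG ▸ Submodule.mem_top
        induction hm using Submodule.span_induction with
        | mem m hm => exact Submodule.subset_span ⟨m, hm, rfl⟩
        | zero => rw [map_zero]; exact zero_mem _
        | add m m' _ _ hm hm' => rw [map_add]; exact add_mem hm hm'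
        | smul a m _ hm =>
          rw [SetLike.mem_coe, hφ, hbase a, ← base_smul_def W U]
          exact Submodule.smul_mem _ _ hm
      · exact Submodule.span_mono (by rintro _ ⟨m, -, rfl⟩; exact ⟨m, rfl⟩)
    haveI : Module.Finite Γ(X, U) (Submodule.span Γ(X, U) (Set.range φ) : Submodule Γ(X, U) W) :=
      ⟨(Submodule.fg_top _).mpr (Submodule.fg_def.mpr
        ⟨φ '' (G : Set M), G.finite_toSet.image φ, hspan.symm⟩)⟩
    exact Module.Finite.equiv (sectionsEquivSpan W (Set.range φ) hU x).symm

section Normal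

variable [IsDomain T] [IsNoetherianRing T] [IsLocalRing T] [IsIntegrallyClosed T]

/-- **G2 (iv): the full sheaf `M̃ = 𝒪_X · φ(M)` is finite locally free** — for `π : X ⟶ Spec T` a
resolution of a two-dimensional noetherian normal local domain `T`, `M` a finitely generated reflexive
`T`-module and `φ : M ↪ K(X)^r` `T`-semilinear along `T → K(X)` — GIVEN G2 (iii), the vanishing of
`Ȟ¹(𝒰, M̃)` on finite affine open covers (res-D-pv-024's `fullSheaf_cechMH1_subsingleton`, here the
hypothesis `hH1` in exactly that shape).  Every stalk lattice is free (p508328 `free_stalkSpan`), and free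
stalks give local frames (`isFiniteLocallyFree_of_free_stalkSpan`).
[cite: ArtinVerdier1985, Lemma (1.1) (ii)] -/
theorem fullSheaf_isFiniteLocallyFree_of_cechH1 [IsLocallyNoetherian X] [Module.Finite T M]
    (hdim : ringKrullDim T = 2) (hπ : IsResolution π) (hM : Module.IsReflexive T M)
    (hφ : ∀ (a : T) (m : M), φ (a • m) = baseToFunctionField π a • φ m) (hφinj : Function.Injective φ)
    (hH1 : ∀ (ι : Type) [Finite ι] (U : ι → X.Opens), (∀ i, IsAffineOpen (U i)) → ⨆ i, U i = ⊤ →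
      Subsingleton (CechMH1 π (generatedSheaf (Fin r → X.functionField) (Set.range φ)) U)) :
    IsFiniteLocallyFree (generatedSheaf (X := X) (Fin r → X.functionField) (Set.range φ)) :=
  isFiniteLocallyFree_of_free_stalkSpan (Fin r → X.functionField) (Set.range φ)
    (isAffineFiniteType_generatedSheaf_range π φ hφ)
    (fun y => free_stalkSpan π φ hdim hπ hM hφ hφinj hH1 y)

end Normal

end Summit.ResolutionOfSingularities.ResolutionOfSingularities.Theorems.NoZeno.SandwichCluster.FullSheaf

end
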